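import Literature.AlgebraicGeometry.Modules.FittingIdealSheafOfModule
import Literature.AlgebraicGeometry.Motives.OpenSubfunctorRepresentable
import Literature.RingTheory.FittingIdeal.LocallyFreeRankLocus
import HarnessLib

/-!
# The loci «`F_T` is generated by `≤ r` sections» and «`F_T` is locally free of rank `r`» are represented
# by an open subscheme and by a locally closed subscheme (Stacks 05P8)

Topic `Literature/AlgebraicGeometry/Modules`, namespace `Literature.AlgebraicGeometry.Modules`.  THEOREMS ONLY (no
definition, no instance, no notation, no named fact, no `sorry`).

The Stacks Project, Tag 05P8 (Divisors, Lemma 31.9.6): "Let `S` be a scheme. Let `F` be a finite type, quasi-coherent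
`𝒪_S`-module. The closed subschemes `S = Z_{-1} ⊃ Z_0 ⊃ Z_1 ⊃ Z_2 …` defined by the Fitting ideals of `F` have the
following properties (1) The intersection `⋂ Z_r` is empty. (2) The functor `(Sch/S)^opp → Sets` defined by the rule
`T ↦ {∗}` if `F_T` is locally generated by `≤ r` sections, `∅` otherwise, is representable by the open subscheme
`S ∖ Z_r`. (3) The functor `F_r : (Sch/S)^opp → Sets` defined by the rule `T ↦ {∗}` if `F_T` locally free rank `r`,
`∅` otherwise, is representable by the locally closed subscheme `Z_{r-1} ∖ Z_r` of `S`."  Proof (loc. cit.): "For any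
morphism `g : T → S` we see from Lemmas 31.9.1 and 31.9.4 that `F_T` is locally generated by `≤ r` sections if and only
if `Fit_r(F)·𝒪_T = 𝒪_T`. This proves (2). For any morphism `g : T → S` we see from Lemmas 31.9.1 and 31.9.5 that `F_T`
is free of rank `r` if and only if `Fit_r(F)·𝒪_T = 𝒪_T` and `Fit_{r-1}(F)·𝒪_T = 0`. This proves (3)."

Here, for `F : S.Modules` affine-localizing (= quasi-coherent) of affine-finite type, with the Fitting ideal sheaves
`Fit_k(F)` of ★ `Modules/FittingIdealSheafOfModule` and their base-change rules
(★ `fittingIdealSheaf_pullback_eq_top_iff`, ★ `fittingIdealSheaf_pullback_eq_bot_iff` — Stacks 0C3D):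

* §1 THE CONDITIONS IN MODULE CURRENCY (Stacks 0C3G = 07ZD affine-locally, ★ `FittingIdeal/LocallyFreeRankLocus`):
  `fittingIdealSheaf_eq_top_iff_forall_exists_span` («`Fit_r(E) = 𝒪` iff `Γ(V, E)` is generated by `r` elements
  locally» — in the form: iff for every affine `V`, `Fit_r(Γ(V, E)) = Γ(V, 𝒪)`), and
  **`fittingIdealSheaf_conditions_iff_forall_projective_rankAtStalk`**: `Fit_r(E) = 𝒪 ∧ ∀ k < r, Fit_k(E) = 0` iff
  for every affine open `V`, `Γ(V, E)` is a finite projective `Γ(V, 𝒪)`-module of constant rank `r`.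
* §2 (05P8 (2)) for a subfunctor `P ⊆ h_S` whose `T`-points are the `g : T ⟶ S` with `Fit_r(g^*F) = 𝒪_T`:
  **`exists_iso_yoneda_compl_support_rankLE`** (`P ≅ h_{S ∖ Z_r}` compatibly with the inclusions — in particular
  `P` is representable, ★ `Motives.isRepresentable_of_closedCondition`-style one-liner not restated),
  **`isOpenImmersion_of_rankLE`** and `range_eq_of_rankLE` (any classifying morphism is an open immersion with image
  `S ∖ Z_r`), and `exists_subfunctor_rankLE` (the subfunctor exists).
* §3 (05P8 (3)) for the sub-subfunctor `Q ⊆ P` cut out by `Fit_k(g^*F) = 0 (k < r)`: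
  **`isImmersion_of_rankEq`** (any classifying morphism is an immersion) and
  **`exists_iso_yoneda_immersion_rankEq`** (a representing scheme with immersive classifying morphism exists), via
  ★ `Motives.isRepresentable_of_closedCondition_of_openCondition` / `isImmersion_…`; `exists_subfunctor_rankEq`.

Cell `hodgecm-mathlib` (D-0151) count-neutral Mathlib-side capital (F-DAG F-5 (5b)/(5d): the flattening
stratification by Fitting ideals, `Hilb ↪ Grass`); nothing here is about HC — HC_CM is proved only modulo the 7
printed citations until rung 0 closes.

## References

* The Stacks Project, Tags 05P8, 0C3G, 0C3D (Divisors §31.9), 07ZD (More on Algebra 15.8.8). [StacksProject]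
* U. Görtz, T. Wedhorn, *Algebraic Geometry I*, 2nd ed. (2020), (8.4), Thm. 8.9 (p. 212). [GortzWedhorn2020]
-/

noncomputable section

-- `TopCat.Presheaf`/`Scheme.Modules` are not reducible (as in Mathlib's `AlgebraicGeometry/Modules`).
set_option backward.isDefEq.respectTransparency false

open CategoryTheory AlgebraicGeometry TopologicalSpace Opposite

universe u

namespace Literature.AlgebraicGeometry.Modules

open Literature.RingTheory.FittingIdeal Literature.AlgebraicGeometry.Motives

/-! ## §1 The Fitting-sheaf conditions in module currency (Stacks 0C3G / 07ZD) -/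

section Conditions

variable {X : Scheme.{u}} {E : X.Modules} (hE : IsAffineLocalizing E) (hfin : IsAffineFiniteType E)

/-- `Fit_r(E) = 𝒪_X` iff `Fit_r(Γ(V, E)) = Γ(V, 𝒪_X)` for every affine open `V` (iff `Γ(V, E)_𝔭` is generated by `r`
elements at every point, Stacks 0C3F / 07ZC). [cite: StacksProject, Tag 0C3G] -/
theorem fittingIdealSheaf_eq_top_iff (r : ℕ) :
    fittingIdealSheaf E hE hfin r = ⊤ ↔ ∀ V : X.affineOpens, Module.fittingIdeal Γ(X, V) Γ(E, V) r = ⊤ := by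
  constructor
  · intro h V
    rw [← ideal_fittingIdealSheaf hE hfin r V, h, Scheme.IdealSheafData.ideal_top, Pi.top_apply]
  · intro h
    exact Scheme.IdealSheafData.ext (funext fun V => by
      rw [ideal_fittingIdealSheaf, h V, Scheme.IdealSheafData.ideal_top, Pi.top_apply])

/-- `Fit_k(E) = 0` iff `Fit_k(Γ(V, E)) = 0` for every affine open `V`. [cite: StacksProject, Tag 0C3G] -/
theorem fittingIdealSheaf_eq_bot_iff (k : ℕ) :
    fittingIdealSheaf E hE hfin k = ⊥ ↔ ∀ V : X.affineOpens, Module.fittingIdeal Γ(X, V) Γ(E, V) k = ⊥ := by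
  constructor
  · intro h V
    rw [← ideal_fittingIdealSheaf hE hfin k V, h, Scheme.IdealSheafData.ideal_bot, Pi.bot_apply]
  · intro h
    exact Scheme.IdealSheafData.ext (funext fun V => by
      rw [ideal_fittingIdealSheaf, h V, Scheme.IdealSheafData.ideal_bot, Pi.bot_apply])

/-- **Stacks 0C3G (Divisors, Lemma 31.9.5) in module currency**: for `E` affine-localizing of affine-finite type,
`Fit_r(E) = 𝒪_X` and `Fit_k(E) = 0` for `k < r` iff over every affine open `V` the sections `Γ(V, E)` form a finite
projective `Γ(V, 𝒪_X)`-module of constant rank `r` («`E` is finite locally free of rank `r`»; ★ Stacks 07ZD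
`Module.projective_and_rankAtStalk_eq_iff_fittingIdeal` on each `V`). [cite: StacksProject, Tag 0C3G]
[cite: StacksProject, Tag 07ZD] -/
theorem fittingIdealSheaf_conditions_iff_forall_projective_rankAtStalk (r : ℕ) :
    (fittingIdealSheaf E hE hfin r = ⊤ ∧ ∀ k < r, fittingIdealSheaf E hE hfin k = ⊥) ↔
      ∀ V : X.affineOpens, Module.Projective Γ(X, V) Γ(E, V) ∧
        ∀ p : PrimeSpectrum Γ(X, V), Module.rankAtStalk Γ(E, V) p = r := by
  simp only [fittingIdealSheaf_eq_top_iff, fittingIdealSheaf_eq_bot_iff]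
  constructor
  · rintro ⟨htop, hbot⟩ V
    haveI : Module.Finite Γ(X, V) Γ(E, V) := hfin V.2
    exact Module.projective_and_rankAtStalk_eq_iff_fittingIdeal.mpr ⟨htop V, fun k hk => hbot k hk V⟩
  · intro h
    have h' : ∀ V : X.affineOpens, Module.fittingIdeal Γ(X, V) Γ(E, V) r = ⊤ ∧
        ∀ k < r, Module.fittingIdeal Γ(X, V) Γ(E, V) k = ⊥ := fun V => by
      haveI : Module.Finite Γ(X, V) Γ(E, V) := hfin V.2
      exact Module.projective_and_rankAtStalk_eq_iff_fittingIdeal.mp (h V)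
    exact ⟨fun V => (h' V).1, fun k hk V => (h' V).2 k hk⟩

end Conditions

/-! ## §2 Stacks 05P8 (2): «generated by `≤ r` sections» is represented by the open `S ∖ Z_r` -/

section RankLE

variable {S : Scheme.{u}} {F : S.Modules} (hF : IsAffineLocalizing F) (hfin : IsAffineFiniteType F) (r : ℕ)

/-- The pull-back of `F` along a composite, up to isomorphism: `(h ≫ g)^*F ≅ h^*(g^*F)` (Mathlib
`Scheme.Modules.pullbackComp`). [folklore] -/
private theorem fittingIdealSheaf_pullback_comp {T T' : Scheme.{u}} (g : T ⟶ S) (h : T' ⟶ T) (k : ℕ) :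
    fittingIdealSheaf ((Scheme.Modules.pullback (h ≫ g)).obj F) (hF.pullback (h ≫ g)) (hfin.pullback (h ≫ g) hF) k =
      fittingIdealSheaf ((Scheme.Modules.pullback h).obj ((Scheme.Modules.pullback g).obj F))
        ((hF.pullback g).pullback h) ((hfin.pullback g hF).pullback h (hF.pullback g)) k :=
  fittingIdealSheaf_eq_of_iso ((Scheme.Modules.pullbackComp h g).app F).symm _ _ _ _ k

/-- **The membership rule of 05P8 (2) is an OPEN CONDITION** (currency of ★ `Motives/OpenSubfunctorRepresentable`):
`Fit_r((h ≫ g)^*F) = 𝒪_{T'}` iff `h` lands in the open `T ∖ Z_r(g^*F)`. [cite: StacksProject, Tag 05P8] -/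
theorem fittingIdealSheaf_pullback_comp_eq_top_iff {T T' : Scheme.{u}} (g : T ⟶ S) (h : T' ⟶ T) :
    fittingIdealSheaf ((Scheme.Modules.pullback (h ≫ g)).obj F) (hF.pullback (h ≫ g)) (hfin.pullback (h ≫ g) hF) r
        = ⊤ ↔
      Set.range h.base ⊆ ((fittingIdealSheaf ((Scheme.Modules.pullback g).obj F) (hF.pullback g)
        (hfin.pullback g hF) r).support.compl : Set T) := by
  rw [fittingIdealSheaf_pullback_comp hF hfin g h r, fittingIdealSheaf_pullback_eq_top_iff, Closeds.coe_compl]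

variable (P : Subfunctor (yoneda.obj S))
  (hP : ∀ {T : Scheme.{u}} (g : T ⟶ S), g ∈ P.obj (op T) ↔
    fittingIdealSheaf ((Scheme.Modules.pullback g).obj F) (hF.pullback g) (hfin.pullback g hF) r = ⊤)

include hP in
/-- The open-condition hypothesis `hU` of ★ `Motives.exists_iso_yoneda_opens` for the rank-`≤ r` subfunctor.
[cite: StacksProject, Tag 05P8] -/
theorem rankLE_openCondition {T T' : Scheme.{u}} (g : (yoneda.obj S).obj (op T)) (h : T' ⟶ T) :
    (yoneda.obj S).map h.op g ∈ P.obj (op T') ↔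
      Set.range h.base ⊆ ((fittingIdealSheaf ((Scheme.Modules.pullback g).obj F) (hF.pullback g)
        (hfin.pullback g hF) r).support.compl : Set T) := by
  change h ≫ g ∈ P.obj (op T') ↔ _
  rw [hP, fittingIdealSheaf_pullback_comp_eq_top_iff hF hfin r g h]

include hP in
/-- **Stacks 05P8 (2)**: the subfunctor `P ⊆ h_S` of the `g : T → S` with `Fit_r(g^*F) = 𝒪_T` («`F_T` is locally
generated by `≤ r` sections») is represented by the open subscheme `S ∖ Z_r`, `Z_r = Supp(𝒪_S/Fit_r(F))` — precisely
by `(S ∖ Z_r(𝟙^*F))`, compatibly with the inclusions into `h_S`. [cite: StacksProject, Tag 05P8]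
[cite: GortzWedhorn2020, Thm. 8.9 (p. 212)] -/
theorem exists_iso_yoneda_compl_support_rankLE :
    ∃ e : yoneda.obj ((fittingIdealSheaf ((Scheme.Modules.pullback (𝟙 S)).obj F) (hF.pullback (𝟙 S))
        (hfin.pullback (𝟙 S) hF) r).support.compl : Scheme.{u}) ≅ P.toFunctor,
      e.hom ≫ P.ι = yoneda.map (Scheme.Opens.ι _) ≫ (Iso.refl (yoneda.obj S)).hom := by
  have h := exists_iso_yoneda_opens (Iso.refl (yoneda.obj S)) P
    (fun {T} (g : (yoneda.obj S).obj (op T)) => (fittingIdealSheaf ((Scheme.Modules.pullback g).obj F)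
      (hF.pullback g) (hfin.pullback g hF) r).support.compl)
    (fun g h => rankLE_openCondition hF hfin r P hP g h)
  exact h

include hP in
/-- **Stacks 05P8 (2), the classifying morphism**: for ANY representing pair `(Y, e : h_Y ≅ P)` the classifying
morphism `g : Y ⟶ S` (`h_g = e ≫ (P ↪ h_S)`) is an OPEN IMMERSION. [cite: StacksProject, Tag 05P8]
[cite: GortzWedhorn2020, Thm. 8.9 (p. 212)] -/
theorem isOpenImmersion_of_rankLE {Y : Scheme.{u}} (e : yoneda.obj Y ≅ P.toFunctor) (g : Y ⟶ S)
    (hg : yoneda.map g ≫ (Iso.refl (yoneda.obj S)).hom = e.hom ≫ P.ι) : IsOpenImmersion g :=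
  isOpenImmersion_of_openCondition (Iso.refl (yoneda.obj S)) P _
    (fun g h => rankLE_openCondition hF hfin r P hP g h) e g hg

include hP in
/-- **Stacks 05P8 (2), the image**: the classifying morphism of any representing pair has image
`S ∖ Z_r(𝟙^*F)`. [cite: StacksProject, Tag 05P8] -/
theorem range_eq_of_rankLE {Y : Scheme.{u}} (e : yoneda.obj Y ≅ P.toFunctor) (g : Y ⟶ S)
    (hg : yoneda.map g ≫ (Iso.refl (yoneda.obj S)).hom = e.hom ≫ P.ι) :
    Set.range g.base = ((fittingIdealSheaf ((Scheme.Modules.pullback (𝟙 S)).obj F) (hF.pullback (𝟙 S))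
        (hfin.pullback (𝟙 S) hF) r).support.compl : Set S) := by
  have h := range_eq_of_openCondition (Iso.refl (yoneda.obj S)) P
    (fun {T} (g : (yoneda.obj S).obj (op T)) => (fittingIdealSheaf ((Scheme.Modules.pullback g).obj F)
      (hF.pullback g) (hfin.pullback g hF) r).support.compl)
    (fun g h => rankLE_openCondition hF hfin r P hP g h) e g hg
  exact h

/-- **The rank-`≤ r` subfunctor exists**: the `g : T → S` with `Fit_r(g^*F) = 𝒪_T` form a subfunctor of `h_S` (the
condition is stable under base change, Stacks 0C3D). [cite: StacksProject, Tag 05P8] -/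
theorem exists_subfunctor_rankLE :
    ∃ P : Subfunctor (yoneda.obj S), ∀ {T : Scheme.{u}} (g : T ⟶ S), g ∈ P.obj (op T) ↔
      fittingIdealSheaf ((Scheme.Modules.pullback g).obj F) (hF.pullback g) (hfin.pullback g hF) r = ⊤ := by
  let P₀ : Subfunctor (yoneda.obj S) :=
    { obj := fun T => setOf fun g : (yoneda.obj S).obj T =>
        fittingIdealSheaf ((Scheme.Modules.pullback g).obj F) (hF.pullback g) (hfin.pullback g hF) r = ⊤
      map := by
        intro T T' h g hg
        change fittingIdealSheaf ((Scheme.Modules.pullback (h.unop ≫ g)).obj F) _ _ r = ⊤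
        rw [fittingIdealSheaf_pullback_comp_eq_top_iff hF hfin r g h.unop]
        rintro _ ⟨t, rfl⟩
        have hs : (fittingIdealSheaf ((Scheme.Modules.pullback g).obj F) (hF.pullback g)
            (hfin.pullback g hF) r).support = ⊥ := by
          rw [Scheme.IdealSheafData.support_eq_bot_iff]; exact hg
        rw [Closeds.coe_compl, Set.mem_compl_iff, hs, Closeds.coe_bot]
        exact fun ht => ht }
  exact ⟨P₀, fun g => Iff.rfl⟩

end RankLE

/-! ## §3 Stacks 05P8 (3): «locally free of rank `r`» is represented by a locally closed subscheme -/

section RankEq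

variable {S : Scheme.{u}} {F : S.Modules} (hF : IsAffineLocalizing F) (hfin : IsAffineFiniteType F) (r : ℕ)
  (P : Subfunctor (yoneda.obj S))
  (hP : ∀ {T : Scheme.{u}} (g : T ⟶ S), g ∈ P.obj (op T) ↔
    fittingIdealSheaf ((Scheme.Modules.pullback g).obj F) (hF.pullback g) (hfin.pullback g hF) r = ⊤)
  (Q : Subfunctor P.toFunctor)
  (hQ : ∀ {T : Scheme.{u}} (g : P.toFunctor.obj (op T)), g ∈ Q.obj (op T) ↔
    ∀ k < r, fittingIdealSheaf ((Scheme.Modules.pullback (g : T ⟶ S)).obj F) (hF.pullback _) (hfin.pullback _ hF) k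
      = ⊥)

/-- **The membership rule of 05P8 (3) is a CLOSED CONDITION on the open part** (currency of ★
`Motives/ClosedSubfunctorRepresentable`): `Fit_k((h ≫ g)^*F) = 0` for all `k < r` iff the ideal sheaf
`⨆_{k<r} Fit_k(g^*F)` dies under `h`. [cite: StacksProject, Tag 05P8] -/
theorem forall_fittingIdealSheaf_pullback_comp_eq_bot_iff {T T' : Scheme.{u}} (g : T ⟶ S) (h : T' ⟶ T) :
    (∀ k < r, fittingIdealSheaf ((Scheme.Modules.pullback (h ≫ g)).obj F) (hF.pullback (h ≫ g))
        (hfin.pullback (h ≫ g) hF) k = ⊥) ↔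
      (⨆ (k : ℕ) (_ : k < r), fittingIdealSheaf ((Scheme.Modules.pullback g).obj F) (hF.pullback g)
        (hfin.pullback g hF) k) ≤ h.ker := by
  rw [iSup₂_le_iff]
  refine forall₂_congr fun k _ => ?_
  rw [fittingIdealSheaf_pullback_comp hF hfin g h k, fittingIdealSheaf_pullback_eq_bot_iff]

include hQ in
/-- The closed-condition hypothesis `hI` of ★ `Motives.isRepresentable_of_closedCondition_of_openCondition` for the
rank-`r` sub-subfunctor. [cite: StacksProject, Tag 05P8] -/
theorem rankEq_closedCondition {T T' : Scheme.{u}} (y : P.toFunctor.obj (op T)) (h : T' ⟶ T) :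
    P.toFunctor.map h.op y ∈ Q.obj (op T') ↔
      (⨆ (k : ℕ) (_ : k < r), fittingIdealSheaf ((Scheme.Modules.pullback (y : T ⟶ S)).obj F) (hF.pullback _)
        (hfin.pullback _ hF) k) ≤ h.ker := by
  rw [hQ, ← forall_fittingIdealSheaf_pullback_comp_eq_bot_iff hF hfin r]
  rfl

include hP hQ in
/-- **Stacks 05P8 (3), the classifying morphism is an IMMERSION**: for ANY representing pair `(Z, e : h_Z ≅ Q)` the
morphism `g : Z ⟶ S` with `h_g = e ≫ (Q ↪ P ↪ h_S)` is an immersion (a closed immersion into `S ∖ Z_r` followed by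
the open immersion) — the locally closed stratum `Z_{r-1} ∖ Z_r`. [cite: StacksProject, Tag 05P8]
[cite: GortzWedhorn2020, Thm. 8.9 (p. 212)] -/
theorem isImmersion_of_rankEq {Z : Scheme.{u}} (e : yoneda.obj Z ≅ Q.toFunctor) (g : Z ⟶ S)
    (hg : yoneda.map g ≫ (Iso.refl (yoneda.obj S)).hom = e.hom ≫ Q.ι ≫ P.ι) : IsImmersion g :=
  isImmersion_of_closedCondition_of_openCondition (Iso.refl (yoneda.obj S)) P _
    (fun g h => rankLE_openCondition hF hfin r P hP g h) Q _
    (fun y h => rankEq_closedCondition hF hfin r P Q hQ y h) e g hg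

include hP hQ in
/-- **Stacks 05P8 (3), representability by a locally closed subscheme**: the subfunctor of `h_S` of the
`g : T → S` with `Fit_r(g^*F) = 𝒪_T` and `Fit_k(g^*F) = 0` for `k < r` («`F_T` is finite locally free of rank `r`»,
★ 0C3G) is represented by a scheme `Z` whose classifying morphism `Z ⟶ S` is an immersion (the stratum
`Z_{r-1} ∖ Z_r`; ★ `Motives.isRepresentable_of_closedCondition_of_openCondition` supplies `Z`).
[cite: StacksProject, Tag 05P8] [cite: GortzWedhorn2020, Thm. 8.9 (p. 212)] -/
theorem exists_iso_yoneda_immersion_rankEq :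
    ∃ (Z : Scheme.{u}) (e : yoneda.obj Z ≅ Q.toFunctor) (g : Z ⟶ S),
      IsImmersion g ∧ yoneda.map g = e.hom ≫ Q.ι ≫ P.ι := by
  obtain ⟨Z, ⟨hZ⟩⟩ := (isRepresentable_of_closedCondition_of_openCondition (Iso.refl (yoneda.obj S)) P _
    (fun g h => rankLE_openCondition hF hfin r P hP g h) Q _
    (fun y h => rankEq_closedCondition hF hfin r P Q hQ y h)).has_representation
  let e : yoneda.obj Z ≅ Q.toFunctor := Functor.representableByEquiv hZ
  let g : Z ⟶ S := Yoneda.fullyFaithful.preimage (e.hom ≫ Q.ι ≫ P.ι)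
  have hg : yoneda.map g ≫ (Iso.refl (yoneda.obj S)).hom = e.hom ≫ Q.ι ≫ P.ι := by
    rw [Iso.refl_hom, Category.comp_id]
    exact Yoneda.fullyFaithful.map_preimage _
  refine ⟨Z, e, g, isImmersion_of_rankEq hF hfin r P hP Q hQ e g hg, ?_⟩
  rw [← hg, Iso.refl_hom, Category.comp_id]

omit hP in
/-- **The rank-`r` sub-subfunctor exists**: inside the rank-`≤ r` subfunctor `P`, the points with
`Fit_k(g^*F) = 0 (k < r)` form a subfunctor (stability under base change, Stacks 0C3D). [cite: StacksProject, Tag 05P8] -/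
theorem exists_subfunctor_rankEq :
    ∃ Q : Subfunctor P.toFunctor, ∀ {T : Scheme.{u}} (g : P.toFunctor.obj (op T)), g ∈ Q.obj (op T) ↔
      ∀ k < r, fittingIdealSheaf ((Scheme.Modules.pullback (g : T ⟶ S)).obj F) (hF.pullback _)
        (hfin.pullback _ hF) k = ⊥ := by
  let Q₀ : Subfunctor P.toFunctor :=
    { obj := fun T => setOf fun g : P.toFunctor.obj T =>
        ∀ k < r, fittingIdealSheaf ((Scheme.Modules.pullback (g : unop T ⟶ S)).obj F)
          (hF.pullback _) (hfin.pullback _ hF) k = ⊥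
      map := by
        intro T T' h g hg
        change ∀ k < r,
          fittingIdealSheaf ((Scheme.Modules.pullback (h.unop ≫ (g : unop T ⟶ S))).obj F) _ _ k = ⊥
        rw [forall_fittingIdealSheaf_pullback_comp_eq_bot_iff hF hfin r (g : unop T ⟶ S) h.unop, iSup₂_le_iff]
        intro k hk
        rw [hg k hk]
        exact bot_le }
  exact ⟨Q₀, fun g => Iff.rfl⟩

end RankEq

end Literature.AlgebraicGeometry.Modules

end
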